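import Literature.Barriers.Parity.SiegelZeroGoldbachTheorem1Prep
import HarnessLib

/-!
# Goldston–Suriajaya, Theorem 1, proved from the prime number theorem for progressions
# with the exceptional-zero term

Sibling of `Literature/Barriers/Parity/SiegelZeroPrimePairs.lean`. Everything in this file is
PROVED; the main result is

* `Literature.Barriers.Parity.GoldstonSuriajaya2021_goldbach_of_pagePNT :
    Literature.NumberTheory.LFunctions.PagePNTWithExceptionalZero → GoldstonSuriajaya2021_goldbach`

— Goldston–Suriajaya (arXiv:2104.09407), Theorem 1: "Assume the Weak Hardy–Littlewood Goldbach
Conjecture. Let `q` be sufficiently large, and suppose that `χ₁` is the single real character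
(mod `q`), if it exists, for which `L(s, χ₁)` has a real zero `β₁` satisfying `1 − c/log q < β₁`
for a certain positive absolute constant `c`. Then we have `β₁ < 1 − C(δ)/log²q` … if
`χ(−1) = −1` then this follows from (A) in (5), and if `χ(−1) = 1` then this follows from (B)",
CONDITIONAL only on the tree's named fact
`Literature.NumberTheory.LFunctions.PagePNTWithExceptionalZero` = Montgomery–Vaughan Cor. 11.17
(11.29), which is exactly the source's input (PNTAP) (§4), and which the tree proves
(`PagePNTWithExceptionalZero_holds`); the unconditional `GoldstonSuriajaya2021_goldbach_holds` is
the one-line composition recorded in `SiegelZeroPrimePairsHolds.lean`.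

## The argument (GS21 §§2–5, with the weight `ρ = 1 − 1/N`)

Let `c, c₁, K` be the constants of (11.29), `c' = min(c, 1)`; the theorem holds with `c'/3`.
Given `0 < δ < 1` and the conjecture (threshold `n₀`), put `A = 4/c₁²`, `C = δ/(128(2A + 6))`,
take `K₀` from the lower half of GS21 Lemma 1 with `η = δ/64` (tree:
`Literature.NumberTheory.Sieve.SingularSeriesMean.sum_goldbachSingularSeries_mul_ge`),
`L = ⌈384/δ⌉ + 1`, and let `q` be large. Suppose `χ` mod `q` is quadratic,
`1 − c'/(3 log q) < β < 1`, `L(β, χ) = 0` and, for contradiction, `β ≥ 1 − C/log²q`.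

1. `χ ≠ χ₀` (`L(β, χ₀) ≠ 0` on `(0, 1)`), and we pass to the even modulus `q' = 2q` with the
   induced character `χ'` (quadratic, `≠ χ₀`, `L(β, χ') = 0`, `β > 1 − c/log 4q'`), so that every
   positive multiple of `q'` is even and `≥ n₀`, and (11.29) holds mod `q'`.
2. `N = q^{2m₀+4}`, `m₀ = ⌈A log q⌉`, `Y = q^{m₀}` (so `e^{−c₁√log n} ≤ q^{−2}` for `n ≥ Y` and
   `(1 − β)log(NL) ≤ δ/64`), `ρ = 1 − 1/N`, `Φ = φ(q')`, `M = (N − 1)/Φ`.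
3. Prime side (GS21 §4): for `(b, q') = 1`, `Ψ(ρ; q', b) = M − χ'(b)S + O(E)` with
   `(1 − δ/32)M ≤ S ≤ (3/2)M` and `E ≤ (δ/100)M` (`SiegelZeroGoldbachPrimeSide`, `…Prep`).
4. Goldbach side (GS21 §3): `𝒮 = ∑_k ψ₂(q'k)ρ^{q'k}` lies between `δ q'W` (from (A)) and
   `(2 − δ)q'W` (from (B)), and `(1 − δ/16)ΦM² ≤ q'W ≤ (1 + δ/16)ΦM²`
   (`SiegelZeroGoldbachSingular`, `…Prep`).
5. `χ'(−1) = 1`: `Φ(M² + S² − 2(M+S)E − E²) ≤ 𝒮 ≤ (2 − δ)(1 + δ/16)ΦM²` is absurd;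
   `χ'(−1) = −1`: `δ(1 − δ/16)ΦM² ≤ 𝒮 ≤ Φ(M² − S² + 2(M+S)E + E²) + Z₀²`, `Z₀² ≤ (δ/16)ΦM²`,
   is absurd (GS21 (key)).

The constants differ from the printed `C(δ) = ½(c')²log(1/(1−δ))` (Theorem 3), which the named
fact does not assert; the weight `1 − 1/N` replaces `e^{−1/N}` (so no Gamma factors arise) and the
passage to `2q` replaces the estimate (psi_2odd) for odd `n`.

## References

* D. A. Goldston, A. I. Suriajaya, *Note on the Goldbach conjecture and Landau–Siegel zeros*,
  arXiv:2104.09407 (2021): Theorems 1 and 3, §§2–5. [cite: GoldstonSuriajaya2021, Theorem 1]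
* H. L. Montgomery, R. C. Vaughan, *Multiplicative Number Theory I*, CUP 2007, Cor. 11.17 (11.29)
  (tree: `Literature.NumberTheory.LFunctions.PagePNTWithExceptionalZero`). [cite: MontgomeryVaughan2007, Corollary 11.17 (11.29)]
-/

noncomputable section

open Finset Real
open scoped ArithmeticFunction.vonMangoldt

namespace Literature.Barriers.Parity

namespace GoldstonSuriajaya

open Literature.NumberTheory.Sieve Literature.NumberTheory.LFunctions

/-- The weight `w(n) = e^{−c₁√log n}` is at most `1`. [folklore] -/
theorem exp_neg_mul_sqrt_log_le_one {c₁ : ℝ} (hc₁ : 0 < c₁) (n : ℕ) :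
    Real.exp (-c₁ * Real.sqrt (Real.log n)) ≤ 1 := by
  rw [Real.exp_le_one_iff]
  have := Real.sqrt_nonneg (Real.log n)
  nlinarith

/-- **Goldston–Suriajaya 2021, Theorem 1, proved from Montgomery–Vaughan (11.29).** The named
fact `Literature.NumberTheory.LFunctions.PagePNTWithExceptionalZero` (the prime number theorem for
progressions with the exceptional-zero term, GS21's input (PNTAP)) implies
`GoldstonSuriajaya2021_goldbach`: the Weak Hardy–Littlewood Goldbach Conjecture with constant
`δ` forces `β < 1 − C(δ)/log²q` for every real zero `β > 1 − c/log q` of a real `L(s, χ)` mod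
`q`, `q ≥ q₀(δ)` — bound (B) is used when `χ(−1) = 1` and bound (A) when `χ(−1) = −1`. See the
module docstring for the argument. [cite: GoldstonSuriajaya2021, Theorem 1] -/
theorem _root_.Literature.Barriers.Parity.GoldstonSuriajaya2021_goldbach_of_pagePNT
    (hP : PagePNTWithExceptionalZero) : GoldstonSuriajaya2021_goldbach := by
  obtain ⟨c, hc, c₁, hc₁, K, hK, hP⟩ := hP
  -- the absolute constant: `c'/3`, `c' = min(c, 1)`
  obtain ⟨c', hc'def⟩ : ∃ c' : ℝ, c' = min c 1 := ⟨_, rfl⟩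
  have hc'0 : 0 < c' := hc'def ▸ lt_min hc one_pos
  have hc'c : c' ≤ c := hc'def ▸ min_le_left _ _
  have hc'1 : c' ≤ 1 := hc'def ▸ min_le_right _ _
  refine ⟨c' / 3, by positivity, fun δ hδ hδ1 hconj => ?_⟩
  -- constants depending on `δ`
  obtain ⟨A, hAdef⟩ : ∃ A : ℝ, A = 4 / c₁ ^ 2 := ⟨_, rfl⟩
  have hA0 : 0 < A := hAdef ▸ by positivity
  obtain ⟨C, hCdef⟩ : ∃ C : ℝ, C = δ / (128 * (2 * A + 6)) := ⟨_, rfl⟩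
  have hC0 : 0 < C := hCdef ▸ by positivity
  obtain ⟨n₀, hn₀⟩ := hconj
  obtain ⟨K₀, hK₀⟩ := SingularSeriesMean.sum_goldbachSingularSeries_mul_ge (η := δ / 64) (by positivity)
  obtain ⟨L, hLdef⟩ : ∃ L : ℕ, L = ⌈384 / δ⌉₊ + 1 := ⟨_, rfl⟩
  have hL1 : 1 ≤ L := hLdef ▸ Nat.le_add_left 1 _
  have hLδ : 384 / δ < L := by
    rw [hLdef]
    push_cast
    linarith [Nat.le_ceil (384 / δ)]
  obtain ⟨T, hTdef⟩ : ∃ T : ℝ, T = 1800 + 768 + 256 * (3 + 2 * K₀) + 256 + 64 * K₀ := ⟨_, rfl⟩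
  have hT0 : 0 < T := hTdef ▸ by positivity
  obtain ⟨Q, hQdef⟩ : ∃ Q : ℝ, Q = 3 + n₀ + L + 1200 * K / δ + 2048 / δ + 2 * T / δ := ⟨_, rfl⟩
  refine ⟨C, hC0, ⌈Q⌉₊ + 1, fun q _ hq χ hχ β hβ hβ1 hL => ?_⟩
  -- `q` is large
  have hqQ : Q < q := by
    have h1 : (Q : ℝ) ≤ ⌈Q⌉₊ := Nat.le_ceil Q
    have h2 : ((⌈Q⌉₊ + 1 : ℕ) : ℝ) ≤ q := by exact_mod_cast hq
    push_cast at h2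
    linarith
  have hKδ : 0 ≤ 1200 * K / δ := by positivity
  have h2048 : 0 ≤ 2048 / δ := by positivity
  have hTδ : 0 ≤ 2 * T / δ := by positivity
  have hn₀0 : (0 : ℝ) ≤ n₀ := Nat.cast_nonneg n₀
  have hL0 : (0 : ℝ) ≤ L := Nat.cast_nonneg L
  rw [hQdef] at hqQ
  have hq3 : (3 : ℝ) < q := by linarith only [hqQ, hKδ, h2048, hTδ, hn₀0, hL0]
  have hqn₀ : (n₀ : ℝ) < q := by linarith only [hqQ, hKδ, h2048, hTδ, hn₀0, hL0]
  have hqL : (L : ℝ) < q := by linarith only [hqQ, hKδ, h2048, hTδ, hn₀0, hL0]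
  have hqK : 1200 * K / δ < q := by linarith only [hqQ, hKδ, h2048, hTδ, hn₀0, hL0]
  have hq2048 : 2048 / δ < q := by linarith only [hqQ, hKδ, h2048, hTδ, hn₀0, hL0]
  have hqT : 2 * T / δ < q := by linarith only [hqQ, hKδ, h2048, hTδ, hn₀0, hL0]
  have hq4 : 4 ≤ q := by
    have : (3 : ℕ) < q := by exact_mod_cast hq3
    omega
  have hq0 : (0 : ℝ) < q := by linarith
  have hq1 : (1 : ℝ) < q := by linarith
  have hq1' : (1 : ℝ) ≤ q := hq1.le
  have hqne : q ≠ 0 := by omega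
  have hlog4 : (1 : ℝ) < Real.log 4 := by
    rw [show (4 : ℝ) = 2 ^ 2 by norm_num, Real.log_pow]
    have := Real.log_two_gt_d9
    push_cast
    linarith
  have hlogq : 1 < Real.log q :=
    hlog4.trans_le (Real.log_le_log (by norm_num) (by exact_mod_cast hq4))
  have hlogq0 : 0 < Real.log q := by linarith
  have hKq : 1200 * K < δ * q := by
    have := (div_lt_iff₀ hδ).mp hqK
    linarith only [this]
  have h2048q : 2048 < δ * q := by
    have := (div_lt_iff₀ hδ).mp hq2048
    linarith only [this]
  have hTq : 2 * T < δ * q := by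
    have := (div_lt_iff₀ hδ).mp hqT
    linarith only [this]
  -- `β` is close to `1`
  have hβ23 : 2 / 3 < β := by
    have h1 : c' / 3 / Real.log q ≤ 1 / 3 := by
      rw [div_le_iff₀ hlogq0]
      linarith only [hc'1, hlogq]
    linarith only [h1, hβ]
  have hβ0 : 0 < β := by linarith
  by_contra hcon
  rw [not_lt] at hcon
  -- Step 1: `χ ≠ χ₀`
  have hχ1 : χ ≠ 1 := by
    rintro rfl
    exact LFunction_one_ne_zero_of_pos_of_lt_one q hβ0 hβ1 hL
  -- the even modulus `q' = 2q` and the induced character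
  have hdvd : q ∣ 2 * q := Dvd.intro_left 2 rfl
  set χ' := DirichletCharacter.changeLevel hdvd χ with hχ'def
  have hχ'1 : χ' ≠ 1 := fun h => hχ1 ((DirichletCharacter.changeLevel_eq_one_iff hdvd).mp h)
  have hχ'q : χ'.IsQuadratic := by
    intro b
    by_cases hb : IsUnit b
    · obtain ⟨u, rfl⟩ := hb
      rw [hχ'def, DirichletCharacter.changeLevel_eq_cast_of_dvd χ hdvd u]
      exact hχ _
    · exact Or.inl (MulChar.map_nonunit _ hb)
  have hL' : χ'.LFunction β = 0 := by
    rw [hχ'def, DirichletCharacter.LFunction_changeLevel hdvd χ (Or.inl hχ1), hL, zero_mul]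
  have hβ' : 1 - c / Real.log (4 * ((2 * q : ℕ) : ℝ)) < β := one_sub_div_log_lt hc'0 hc'c hq3.le hβ
  have hq'0 : (2 * q : ℕ) ≠ 0 := by positivity
  have hq'R : ((2 * q : ℕ) : ℝ) = 2 * q := by push_cast; ring
  -- Step 2: the lengths `Y = q^{m₀}`, `N = q^{2m₀+4} = Y² q⁴`
  obtain ⟨m₀, hm₀def⟩ : ∃ m₀ : ℕ, m₀ = ⌈A * Real.log q⌉₊ := ⟨_, rfl⟩
  have hm₀A : A * Real.log q ≤ m₀ := hm₀def ▸ Nat.le_ceil _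
  have hm₀A' : (m₀ : ℝ) ≤ A * Real.log q + 1 := by
    have := Nat.ceil_lt_add_one (by positivity : 0 ≤ A * Real.log q)
    rw [hm₀def]
    linarith
  obtain ⟨Y, hYdef⟩ : ∃ Y : ℕ, Y = q ^ m₀ := ⟨_, rfl⟩
  obtain ⟨N, hNdef⟩ : ∃ N : ℕ, N = q ^ (2 * m₀ + 4) := ⟨_, rfl⟩
  have hYR : (Y : ℝ) = (q : ℝ) ^ m₀ := by rw [hYdef, Nat.cast_pow]
  have hNR : (N : ℝ) = (q : ℝ) ^ (2 * m₀ + 4) := by rw [hNdef, Nat.cast_pow]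
  have hNY : (N : ℝ) = (Y : ℝ) ^ 2 * (q : ℝ) ^ 4 := by rw [hNR, hYR, ← pow_mul, ← pow_add]; ring_nf
  have hY1 : (1 : ℝ) ≤ Y := by rw [hYR]; exact one_le_pow₀ hq1'
  have hN4 : (q : ℝ) ^ 4 ≤ N := by
    rw [hNR]
    exact pow_le_pow_right₀ hq1' (by omega)
  have hq4R : (4 : ℝ) ≤ q := by exact_mod_cast hq4
  have hqq : (4 : ℝ) * q ≤ (q : ℝ) ^ 2 := by nlinarith only [hq4R]
  have hq4' : (64 : ℝ) * q ≤ (q : ℝ) ^ 4 := by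
    have h16 : (16 : ℝ) * q ≤ (q : ℝ) ^ 3 := by nlinarith only [hqq, hq4R, hq0]
    nlinarith only [h16, hq4R, hq0]
  have hNq : (2 : ℝ) * q + 2 ≤ N := by linarith only [hq4', hN4, hq1']
  have hN2 : 2 ≤ N := by
    have : (2 : ℝ) ≤ N := by linarith only [hNq, hq0]
    exact_mod_cast this
  have hN1 : 1 ≤ N := le_trans (by norm_num) hN2
  have hN2R : (2 : ℝ) ≤ N := by exact_mod_cast hN2
  have hqN : 2 * q ≤ N := by exact_mod_cast (show ((2 * q : ℕ) : ℝ) ≤ N by push_cast; linarith)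
  -- `δ(N − 1) ≥ T q`
  have hNhalf : (q : ℝ) ^ 4 / 2 ≤ (N : ℝ) - 1 := by linarith only [hN4, hq4', hq1']
  have hδN : T * q ≤ δ * ((N : ℝ) - 1) := by
    have h1 : T ≤ δ * q / 2 := by linarith only [hTq]
    have h2 : δ * q / 2 * q ^ 3 ≤ δ * ((N : ℝ) - 1) := by
      have : δ * ((q : ℝ) ^ 4 / 2) ≤ δ * ((N : ℝ) - 1) := mul_le_mul_of_nonneg_left hNhalf hδ.le
      calc δ * q / 2 * q ^ 3 = δ * ((q : ℝ) ^ 4 / 2) := by ring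
        _ ≤ δ * ((N : ℝ) - 1) := this
    have h3 : (q : ℝ) ≤ q ^ 3 := le_self_pow₀ hq1' (by norm_num)
    calc T * q ≤ δ * q / 2 * q := mul_le_mul_of_nonneg_right h1 hq0.le
      _ ≤ δ * q / 2 * q ^ 3 := mul_le_mul_of_nonneg_left h3 (by positivity)
      _ ≤ δ * ((N : ℝ) - 1) := h2
  have hK₀0 : (0 : ℝ) ≤ K₀ := Nat.cast_nonneg K₀
  have hTge : ∀ a : ℝ, 0 ≤ a → a ≤ T → a * q ≤ δ * ((N : ℝ) - 1) := fun a _ haT =>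
    (mul_le_mul_of_nonneg_right haT hq0.le).trans hδN
  -- logarithms
  have hlogN : Real.log N = (2 * m₀ + 4 : ℕ) * Real.log q := by rw [hNR, Real.log_pow]
  have hmle : ((2 * m₀ + 4 : ℕ) : ℝ) ≤ (2 * A + 6) * Real.log q := by
    push_cast
    nlinarith only [hm₀A', hlogq, hA0]
  -- the totient `Φ = φ(2q)`
  obtain ⟨Φ, hΦdef⟩ : ∃ Φ : ℝ, Φ = (Nat.totient (2 * q) : ℝ) := ⟨_, rfl⟩
  have hΦ0 : 0 < Φ := by
    rw [hΦdef]
    exact_mod_cast Nat.totient_pos.mpr (Nat.pos_of_ne_zero hq'0)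
  have hΦle : Φ ≤ 2 * q := by
    rw [hΦdef]
    exact_mod_cast Nat.totient_le (2 * q)
  have hΦ1 : 1 ≤ Φ := by
    rw [hΦdef]
    exact_mod_cast Nat.totient_pos.mpr (Nat.pos_of_ne_zero hq'0)
  -- the weight `ρ = 1 − 1/N` and the main terms
  have hρ0 := rho_pos hN2
  have hρ1 := rho_lt_one hN1
  obtain ⟨M, hMdef⟩ : ∃ M : ℝ, M = mainM (1 - 1 / (N : ℝ)) Φ := ⟨_, rfl⟩
  have hMval : M = ((N : ℝ) - 1) / Φ := by rw [hMdef, mainM_rho hN1]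
  have hM0 : 0 < M := by rw [hMval]; exact div_pos (by linarith) hΦ0
  have hPM : ((N : ℝ) - 1) ^ 2 / Φ = Φ * M ^ 2 := by rw [hMval]; field_simp
  obtain ⟨S, hSdef⟩ : ∃ S : ℝ, S = excS (1 - 1 / (N : ℝ)) β Φ := ⟨_, rfl⟩
  have hS0 : 0 ≤ S := hSdef ▸ excS_nonneg hρ0.le hρ1.le hβ0.le hΦ0.le
  have hS2 : S ≤ 3 / 2 * M := by
    have h := excS_le hρ0.le hρ1 hβ0 hβ1.le hΦ0
    rw [← hSdef, ← hMdef] at h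
    refine h.trans ?_
    rw [div_le_iff₀ hβ0]
    nlinarith only [hM0, hβ23]
  -- Step 2b: `S ≥ (1 − δ/32)M`
  have hS1 : (1 - δ / 32) * M ≤ S := by
    rw [hSdef, hMval]
    refine excS_ge_inst hN2 hL1 hβ0 hβ1.le hΦ0 hδ1.le ?_ ?_
    · -- `e^{-L}(1 + 2L) ≤ 6/L ≤ δ/64`
      have hL1R : (1 : ℝ) ≤ L := by exact_mod_cast hL1
      have hLpos : (0 : ℝ) < L := by linarith
      refine (exp_neg_mul_le_div hL1R).trans ?_
      rw [div_le_div_iff₀ hLpos (by norm_num)]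
      have := (div_lt_iff₀ hδ).mp hLδ
      linarith only [this]
    · -- `(1 − β) log(NL) ≤ (C/log²q) · 2 log N ≤ 2C(2A+6) = δ/64`
      have h1β : 1 - β ≤ C / Real.log q ^ 2 := by linarith only [hcon]
      have hLN : (L : ℝ) ≤ N := by linarith only [hN4, hq4', hq1', hqL]
      have hL0' : (0 : ℝ) < L := by exact_mod_cast hL1
      have hNL1 : (1 : ℝ) ≤ ((N * L : ℕ) : ℝ) := by
        exact_mod_cast Nat.one_le_iff_ne_zero.mpr (Nat.mul_ne_zero (by omega) (by omega))
      have hNL : Real.log ((N * L : ℕ) : ℝ) ≤ 2 * Real.log N := by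
        push_cast
        rw [Real.log_mul (by positivity) hL0'.ne', two_mul]
        have := Real.log_le_log hL0' hLN
        linarith only [this]
      calc (1 - β) * Real.log ((N * L : ℕ) : ℝ) ≤ (C / Real.log q ^ 2) * (2 * Real.log N) :=
            mul_le_mul h1β hNL (Real.log_nonneg hNL1) (by positivity)
        _ = 2 * C * (((2 * m₀ + 4 : ℕ) : ℝ) * Real.log q) / Real.log q ^ 2 := by rw [hlogN]; ring
        _ ≤ 2 * C * ((2 * A + 6) * Real.log q * Real.log q) / Real.log q ^ 2 := by
            refine div_le_div_of_nonneg_right (mul_le_mul_of_nonneg_left ?_ (by positivity)) (by positivity)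
            exact mul_le_mul_of_nonneg_right hmle hlogq0.le
        _ = 2 * C * (2 * A + 6) := by field_simp
        _ = δ / 64 := by rw [hCdef]; field_simp; ring
  -- Step 3: the prime side, class by class
  obtain ⟨E, hEdef⟩ : ∃ E : ℝ, E = 3 + K * (Y : ℝ) ^ 2 * (1 - (1 - 1 / (N : ℝ))) +
      K * (1 / (q : ℝ) ^ 2) * ((1 - 1 / (N : ℝ)) / (1 - (1 - 1 / (N : ℝ)))) := ⟨_, rfl⟩
  have hE0 : 0 ≤ E := by
    rw [hEdef, rho_div_one_sub_rho hN1, one_sub_rho]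
    have : (0 : ℝ) ≤ (N : ℝ) - 1 := by linarith
    positivity
  have hE : E ≤ δ / 100 * M := by
    rw [hEdef, hMval]
    refine errE_le hN2 (by omega) hΦ0 hΦle (hTge 1800 (by norm_num) (by linarith only [hTdef, hK₀0])) ?_ ?_
    · -- `600 q K Y² ≤ δ N (N − 1)`: `N(N−1) ≥ Y²q⁸/2` and `1200K ≤ δq ≤ δq⁷`
      have hN0 : (0 : ℝ) ≤ N := by linarith only [hN2R]
      have hNN : (Y : ℝ) ^ 2 * (q : ℝ) ^ 8 / 2 ≤ (N : ℝ) * ((N : ℝ) - 1) := by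
        have h1 : (N : ℝ) / 2 ≤ (N : ℝ) - 1 := by linarith only [hN2R]
        have h2 : (Y : ℝ) ^ 2 * (q : ℝ) ^ 8 ≤ (N : ℝ) * N := by
          have hY2 : (1 : ℝ) ≤ (Y : ℝ) ^ 2 := one_le_pow₀ hY1
          calc (Y : ℝ) ^ 2 * (q : ℝ) ^ 8 = 1 * ((Y : ℝ) ^ 2 * (q : ℝ) ^ 8) := by ring
            _ ≤ (Y : ℝ) ^ 2 * ((Y : ℝ) ^ 2 * (q : ℝ) ^ 8) := mul_le_mul_of_nonneg_right hY2 (by positivity)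
            _ = (N : ℝ) * N := by rw [hNY]; ring
        have h3 : (N : ℝ) * ((N : ℝ) / 2) ≤ (N : ℝ) * ((N : ℝ) - 1) := mul_le_mul_of_nonneg_left h1 hN0
        linarith only [h2, h3]
      have hq7 : δ * q ≤ δ * (q : ℝ) ^ 7 := mul_le_mul_of_nonneg_left (le_self_pow₀ hq1' (by norm_num)) hδ.le
      have hY20 : 0 ≤ (Y : ℝ) ^ 2 := sq_nonneg _
      calc 600 * (q : ℝ) * K * (Y : ℝ) ^ 2 = (600 * K) * q * (Y : ℝ) ^ 2 := by ring
        _ ≤ (δ * q / 2) * q * (Y : ℝ) ^ 2 := by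
            refine mul_le_mul_of_nonneg_right (mul_le_mul_of_nonneg_right (by linarith only [hKq]) hq0.le) hY20
        _ ≤ (δ * (q : ℝ) ^ 7 / 2) * q * (Y : ℝ) ^ 2 := by
            refine mul_le_mul_of_nonneg_right (mul_le_mul_of_nonneg_right (by linarith only [hq7]) hq0.le) hY20
        _ = δ * ((Y : ℝ) ^ 2 * (q : ℝ) ^ 8 / 2) := by ring
        _ ≤ δ * ((N : ℝ) * ((N : ℝ) - 1)) := mul_le_mul_of_nonneg_left hNN hδ.le
        _ = δ * N * ((N : ℝ) - 1) := by ring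
    · linarith only [hKq, hK]
  -- the per-class approximation from (11.29) mod `2q`
  have happrox : ∀ b : ZMod (2 * q), IsUnit b →
      |psiGen (2 * q) b (1 - 1 / (N : ℝ)) - (M - (χ' b).re * S)| ≤ E := by
    intro b hb
    rw [hMdef, hSdef, hEdef]
    refine psiGen_sub_main_le b (w := fun n : ℕ => Real.exp (-c₁ * Real.sqrt (Real.log n)))
      (w₀ := 1 / (q : ℝ) ^ 2) (Y := Y) hρ0.le hρ1 hβ0 hβ1.le hK.le (fun n => (Real.exp_pos _).le)
      (fun n => exp_neg_mul_sqrt_log_le_one hc₁ n) (fun n hn => ?_) ?_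
    · -- `e^{-c₁√log n} ≤ q^{-2}` for `n ≥ Y`
      have hn1 : (1 : ℝ) ≤ n := hY1.trans (by exact_mod_cast hn)
      refine exp_neg_mul_sqrt_log_le hc₁ hq1' (Real.log_nonneg hn1) ?_
      calc (2 * Real.log q / c₁) ^ 2 = A * Real.log q * Real.log q := by
            rw [hAdef]; field_simp; ring
        _ ≤ m₀ * Real.log q := mul_le_mul_of_nonneg_right hm₀A hlogq0.le
        _ = Real.log Y := by rw [hYR, Real.log_pow]
        _ ≤ Real.log n := Real.log_le_log (by linarith) (by exact_mod_cast hn)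
    · refine approx_all b (fun n => (Real.exp_pos _).le) hΦ1 hβ23 hβ0.ne' ?_ hK.le fun n hn => ?_
      · rcases re_apply_unit hχ'q hb with h | h <;> rw [h] <;> norm_num
      · have h := hP (2 * q) χ' hχ'1 hχ'q β hβ' hβ1 hL' b hb n (by exact_mod_cast hn)
        rw [← hΦdef] at h
        exact h
  -- Step 4: the Goldbach side — bounds (A), (B) on the multiples of `2q`
  have hmult : ∀ k : ℕ, 1 ≤ k → n₀ ≤ 2 * q * k ∧ Even (2 * q * k) := by
    intro k hk
    refine ⟨?_, ?_⟩
    · have : n₀ < q := by exact_mod_cast hqn₀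
      exact le_of_lt (lt_of_lt_of_le this
        ((Nat.le_mul_of_pos_left q two_pos).trans (Nat.le_mul_of_pos_right _ hk)))
    · rw [mul_assoc]
      exact even_two_mul _
  have hB : ∀ k : ℕ, 1 ≤ k → Even (2 * q * k) → goldbachLambdaCount (2 * q * k) ≤
      (2 - δ) * (goldbachSingularSeries (2 * q * k) * ((2 * q * k : ℕ) : ℝ)) :=
    fun k hk _ => (hn₀ _ (hmult k hk).1 (hmult k hk).2).2
  have hA : ∀ k : ℕ, 1 ≤ k → δ * (goldbachSingularSeries (2 * q * k) * ((2 * q * k : ℕ) : ℝ)) ≤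
      goldbachLambdaCount (2 * q * k) :=
    fun k hk => (hn₀ _ (hmult k hk).1 (hmult k hk).2).1
  have hlow : ∀ K' : ℕ, K₀ ≤ K' →
      (1 - δ / 64) * (((2 * q : ℕ) : ℝ) / Nat.totient (2 * q)) * ((K' : ℝ) - 1) ≤ singG (2 * q) K' :=
    fun K' hK' => hK₀ K' hK' (2 * q) hq'0
  -- the four largeness conditions for `W` and the one for `Z₀`
  have hc4 : 256 * (((2 * q : ℕ) : ℝ) + 1) ≤ δ * ((N : ℝ) - 1) := by
    rw [hq'R]
    have : 256 * ((2 : ℝ) * q + 1) ≤ 768 * q := by linarith only [hq1']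
    exact this.trans (hTge 768 (by norm_num) (by linarith only [hTdef, hK₀0]))
  have hc5 : 128 * (3 / 2 + (K₀ : ℝ)) * ((2 * q : ℕ) : ℝ) ≤ δ * ((N : ℝ) - 1) := by
    rw [hq'R, show 128 * (3 / 2 + (K₀ : ℝ)) * (2 * q) = (256 * (3 / 2 + K₀)) * q by ring]
    exact hTge _ (by positivity) (by linarith only [hTdef, hK₀0])
  have hc7 : 128 * (((2 * q : ℕ) : ℝ) - 1) ≤ δ * ((N : ℝ) - 1) := by
    rw [hq'R]
    have : 128 * ((2 : ℝ) * q - 1) ≤ 256 * q := by linarith only [hq0]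
    exact this.trans (hTge 256 (by norm_num) (by linarith only [hTdef, hK₀0]))
  have hc8 : 32 * ((2 * q : ℕ) : ℝ) * K₀ ≤ δ * ((N : ℝ) - 1) := by
    rw [hq'R, show 32 * ((2 : ℝ) * q) * K₀ = (64 * K₀) * q by ring]
    exact hTge _ (by positivity) (by linarith only [hTdef, hK₀0])
  have hc9 : 64 * (((2 * q : ℕ) : ℝ)) ^ 3 * N ≤ δ * ((N : ℝ) - 1) ^ 2 := by
    rw [hq'R]
    have hN0 : (0 : ℝ) ≤ N := by linarith only [hN2R]
    have h1 : (N : ℝ) / 2 ≤ (N : ℝ) - 1 := by linarith only [hN2R]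
    have h2 : ((N : ℝ) / 2) ^ 2 ≤ ((N : ℝ) - 1) ^ 2 := pow_le_pow_left₀ (by positivity) h1 2
    have h3 : 2048 * (q : ℝ) ^ 3 ≤ δ * N := by
      calc 2048 * (q : ℝ) ^ 3 ≤ (δ * q) * q ^ 3 :=
            mul_le_mul_of_nonneg_right h2048q.le (pow_nonneg hq0.le 3)
        _ = δ * (q : ℝ) ^ 4 := by ring
        _ ≤ δ * N := mul_le_mul_of_nonneg_left hN4 hδ.le
    calc 64 * ((2 : ℝ) * q) ^ 3 * N = (2048 * (q : ℝ) ^ 3) * N / 4 := by ring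
      _ ≤ (δ * N) * N / 4 := by
          refine div_le_div_of_nonneg_right (mul_le_mul_of_nonneg_right h3 hN0) (by norm_num)
      _ = δ * ((N : ℝ) / 2) ^ 2 := by ring
      _ ≤ δ * ((N : ℝ) - 1) ^ 2 := mul_le_mul_of_nonneg_left h2 hδ.le
  have hWle : ((2 * q : ℕ) : ℝ) * singW (2 * q) ((1 - 1 / (N : ℝ)) ^ (2 * q)) ≤
      (1 + δ / 16) * (Φ * M ^ 2) := by
    have h := mul_singW_le_inst hq'0 hN2 hδ hδ1.le hlow hc4 hc5
    rwa [← hΦdef, hPM] at h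
  have hWge : (1 - δ / 16) * (Φ * M ^ 2) ≤
      ((2 * q : ℕ) : ℝ) * singW (2 * q) ((1 - 1 / (N : ℝ)) ^ (2 * q)) := by
    have h := mul_singW_ge_inst hq'0 hN2 hqN hδ hδ1.le hlow hc7 hc8
    rwa [← hΦdef, hPM] at h
  -- Step 5: the parity of `χ'` and the contradiction
  rcases hχ'q (-1) with h0 | heven | hodd
  · exact absurd h0 ((isUnit_one.neg).map χ').ne_zero
  · -- `χ'(−1) = 1`: bound (B)
    have hLB := genPairSum_ge_of_even hχ'1 hχ'q heven hρ0.le hM0.le hS0 happrox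
    rw [← hΦdef] at hLB
    have hUB := genPairSum_le_of_B (δ := δ) (even_two_mul q) hρ0.le hρ1 hB
    rw [mul_assoc] at hUB
    exact even_case_absurd hΦ0 hM0 hδ hδ1 hLB hUB hWle hS1 hS2 hE0 hE
  · -- `χ'(−1) = −1`: bound (A)
    have hUB := genPairSum_le_of_odd hχ'q hodd hρ0.le hM0.le hS0 happrox
    rw [← hΦdef] at hUB
    have hLB := genPairSum_ge_of_A (δ := δ) hρ0.le hρ1 hA
    rw [mul_assoc] at hLB
    have hZ := nonUnitGen_sq_le_inst (q := 2 * q) hN2 hc9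
    rw [← hΦdef, hPM] at hZ
    exact odd_case_absurd hΦ0 hM0 hδ hδ1 hLB hUB hWge hZ hS1 hS2 hE0 hE

end GoldstonSuriajaya

end Literature.Barriers.Parity
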